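import Literature.AlgebraicGeometry.Hu2025.Proofs.S04ModelV.RootParentsR3
import Literature.AlgebraicGeometry.Hu2025.Proofs.S04ModelV.Lem48PlatformN
import HarnessLib

/-!
# Hu 2025 §3 (3.10)–(3.13) / §4.2.2 at the platform `Gr^{3,n}`, EVERY `n`: the term combinatorics behind «no double lift»
# (tail index pairs determine the term; a leading index occurs in at most one term of a block) and the remark p.50 L027
# in READING R3 at every platform `Gr^{3,n}` (file `Proofs/S04ModelV/PlatformTermPairs.lean`; typer of record res-type-042, row 103)

**HONEST FRAMING (D-0012/D-0089).** Kernel bookkeeping on OUR typed platform data (row 101a `primaryTerms`, row 105c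
`relN`/`monoN`/`headN`/`termN`) and OUR rendering `C23L47_R3` (row 103 file d). It upgrades `RootParentsR3PlatformSix`
(`n = 6`, by `decide`) to every `n`: `noDoubleLift` and `C23L47_R3_platform` (every `n`, every commutative `k`, every `Φ`). The
preprint [Hu2025] (arXiv:2507.21400v1) stays «under review»; nothing of it is asserted; AI proof is weaker than expert review.

* §1 index facts of a primary index `u ∈ 𝕀^lt_{3,n}` and the explicit tail terms (displays (3.10)–(3.13)).
* §2 `tail_pair_injective`: the UNORDERED index pair `{u_s, v_s}` of a non-leading term determines the block AND the term
  (across all blocks); `ltIndex_unique_in_block`: an index triple with middle entry `> 3` (every leading index `u_G`) occurs in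
  at most one term of a block.
* §3 `noDoubleLift` (every `n`) and `C23L47_R3_platform` (every `n`).
-/

noncomputable section

namespace Literature.AlgebraicGeometry.Hu2025.Proofs.S04ModelV

open MvPolynomial Literature.AlgebraicGeometry.Hu2025.Statements.S03Pluecker
  Literature.AlgebraicGeometry.Hu2025.Statements.S04ModelV

/-! ## §1 Index facts and the explicit tail terms -/

/-- The coordinates of a relation index `u_G ∈ 𝕀^lt_{3,n}`: `1 ≤ u₁ < u₂ < u₃ ≤ n` and `4 ≤ u₂`.
[cite: Hu2025, §3 (3.5) / (3.10)–(3.13), chunks p0017 l.43–56 / p0018 l.17–33, pp. 35, 37 (unrefereed preprint arXiv:2507.21400v1 under adjudication, D-0012/D-0089 — kernel bookkeeping on OUR typed carriers of rows 101/105; nothing of the source asserted)] -/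
theorem relIdx_coords {n : ℕ} (G : RelIdx n) :
    1 ≤ G.1.1.1 ∧ G.1.1.1 < G.1.1.2.1 ∧ G.1.1.2.1 < G.1.1.2.2 ∧ G.1.1.2.2 ≤ n ∧ 4 ≤ G.1.1.2.1 := by
  have hmem := G.1.2
  unfold plIndexSet at hmem
  simp only [Finset.mem_filter, Finset.mem_product, Finset.mem_Icc] at hmem
  exact ⟨hmem.1.1.1, hmem.2.1, hmem.2.2, hmem.1.2.2.2, four_le_snd_of_isLt G.1.1 G.2 hmem.2.1 hmem.2.2 hmem.1.1.1⟩

/-- **The explicit tail terms** (displays (3.10)–(3.13)): a non-leading term of `F̄_{(123),u}` is one of the printed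
two-index products, by the first coordinate of `u`.
[cite: Hu2025, §3 (3.10)–(3.13), chunk p0018 l.17–33, p.37 (unrefereed preprint arXiv:2507.21400v1 under adjudication, D-0012/D-0089 — kernel bookkeeping on OUR typed carriers of rows 101/105; nothing of the source asserted)] -/
theorem tail_forms {u : ℕ × ℕ × ℕ} (hu : IsLt u) {p : PlTerm} (hp : p ∈ primaryTerms u) (hp0 : p ≠ ⟨1, u, mTri⟩) :
    (u.1 = 1 ∧ (p = ⟨-1, (1, 2, u.2.1), (1, 3, u.2.2)⟩ ∨ p = ⟨1, (1, 3, u.2.1), (1, 2, u.2.2)⟩)) ∨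
    (u.1 = 2 ∧ (p = ⟨-1, (1, 2, u.2.1), (2, 3, u.2.2)⟩ ∨ p = ⟨1, (2, 3, u.2.1), (1, 2, u.2.2)⟩)) ∨
    (u.1 = 3 ∧ (p = ⟨-1, (1, 3, u.2.1), (2, 3, u.2.2)⟩ ∨ p = ⟨1, (2, 3, u.2.1), (1, 3, u.2.2)⟩)) ∨
    (u.1 ≠ 1 ∧ u.1 ≠ 2 ∧ u.1 ≠ 3 ∧ (p = ⟨-1, (1, 2, u.1), (3, u.2.1, u.2.2)⟩ ∨ p = ⟨1, (1, 3, u.1), (2, u.2.1, u.2.2)⟩ ∨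
      p = ⟨-1, (2, 3, u.1), (1, u.2.1, u.2.2)⟩)) := by
  unfold primaryTerms at hp
  rw [if_pos hu] at hp
  split_ifs at hp with h1 h2 h3 <;>
    simp only [List.mem_cons, List.not_mem_nil, or_false] at hp
  · rcases hp with rfl | rfl | rfl
    · exact absurd rfl hp0
    · exact Or.inl ⟨h1, Or.inl rfl⟩
    · exact Or.inl ⟨h1, Or.inr rfl⟩
  · rcases hp with rfl | rfl | rfl
    · exact absurd rfl hp0
    · exact Or.inr (Or.inl ⟨h2, Or.inl rfl⟩)
    · exact Or.inr (Or.inl ⟨h2, Or.inr rfl⟩)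
  · rcases hp with rfl | rfl | rfl
    · exact absurd rfl hp0
    · exact Or.inr (Or.inr (Or.inl ⟨h3, Or.inl rfl⟩))
    · exact Or.inr (Or.inr (Or.inl ⟨h3, Or.inr rfl⟩))
  · rcases hp with rfl | rfl | rfl | rfl
    · exact absurd rfl hp0
    · exact Or.inr (Or.inr (Or.inr ⟨h1, h2, h3, Or.inl rfl⟩))
    · exact Or.inr (Or.inr (Or.inr ⟨h1, h2, h3, Or.inr (Or.inl rfl)⟩))
    · exact Or.inr (Or.inr (Or.inr ⟨h1, h2, h3, Or.inr (Or.inr rfl)⟩))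

/-! ## §2 Tail index pairs determine the term; a leading index occurs at most once per block -/

/-- **The unordered index pair `{u_s, v_s}` of a NON-LEADING term determines the block and the term, across all blocks of
`Gr^{3,n}`** (read off the explicit forms (3.10)–(3.13): the shared small index of the two prefixes gives `u₁` for rank `0`,
the triple with second entry `> 3` marks rank `1`; the third entries give `u₂ < u₃`).
[cite: Hu2025, §3 (3.10)–(3.13), chunk p0018 l.17–33, p.37 (unrefereed preprint arXiv:2507.21400v1 under adjudication, D-0012/D-0089 — kernel bookkeeping on OUR typed carriers of rows 101/105; nothing of the source asserted)] -/
theorem tail_pair_injective {n : ℕ} (F G : RelIdx n) {p q : PlTerm} (hp : p ∈ primaryTerms F.1.1)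
    (hp0 : p ≠ ⟨1, F.1.1, mTri⟩) (hq : q ∈ primaryTerms G.1.1) (hq0 : q ≠ ⟨1, G.1.1, mTri⟩)
    (hs : s(p.us, p.vs) = s(q.us, q.vs)) : F = G ∧ p = q := by
  obtain ⟨hF1, hF12, hF23, -, hF4⟩ := relIdx_coords F
  obtain ⟨hG1, hG12, hG23, -, hG4⟩ := relIdx_coords G
  have hp' := tail_forms F.2 hp hp0
  have hq' := tail_forms G.2 hq hq0
  obtain ⟨⟨⟨a, b, c⟩, huF⟩, hltF⟩ := F
  obtain ⟨⟨⟨a', b', c'⟩, huG⟩, hltG⟩ := G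
  simp only at hF1 hF12 hF23 hF4 hG1 hG12 hG23 hG4 hp' hq' ⊢
  rw [Sym2.eq_iff] at hs
  have key : (a = a' ∧ b = b' ∧ c = c') ∧ p = q := by
    rcases hp' with ⟨hpa, hp⟩ | ⟨hpa, hp⟩ | ⟨hpa, hp⟩ | ⟨hpa1, hpa2, hpa3, hp⟩ <;>
      rcases hq' with ⟨hqa, hq⟩ | ⟨hqa, hq⟩ | ⟨hqa, hq⟩ | ⟨hqa1, hqa2, hqa3, hq⟩ <;>
      rcases hp with rfl | rfl | rfl <;> rcases hq with rfl | rfl | rfl <;>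
      simp only [Prod.mk.injEq, PlTerm.mk.injEq, true_and, and_false, false_and, or_false, false_or, Nat.reduceEqDiff,
        Int.reduceEq, Int.reduceNeg] at hs ⊢ <;> omega
  obtain ⟨⟨rfl, rfl, rfl⟩, rfl⟩ := key
  exact ⟨rfl, rfl⟩

/-- **A leading index occurs in at most one term of a block**: an increasing index triple `w` with middle entry `≥ 4` (every
`u_G ∈ 𝕀^lt_{3,n}`) that occurs among the index triples of two terms `p, q` of `F̄_{(123),u}` forces `p = q` (rank `0`: only the
leading term carries such a triple; rank `1`: `(abc)`, `(3bc)`, `(2bc)`, `(1bc)` sit in four different terms).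
[cite: Hu2025, §3 (3.10)–(3.13), chunk p0018 l.17–33, p.37 (unrefereed preprint arXiv:2507.21400v1 under adjudication, D-0012/D-0089 — kernel bookkeeping on OUR typed carriers of rows 101/105; nothing of the source asserted)] -/
theorem ltIndex_unique_in_block {n : ℕ} (F : RelIdx n) {w : ℕ × ℕ × ℕ} (hw12 : w.1 < w.2.1) (hw4 : 4 ≤ w.2.1)
    {p q : PlTerm} (hp : p ∈ primaryTerms F.1.1) (hq : q ∈ primaryTerms F.1.1) (hpw : p.us = w ∨ p.vs = w)
    (hqw : q.us = w ∨ q.vs = w) : p = q := by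
  obtain ⟨hF1, hF12, hF23, -, hF4⟩ := relIdx_coords F
  have hm : mTri = (1, 2, 3) := rfl
  by_cases hp0 : p = ⟨1, F.1.1, mTri⟩ <;> by_cases hq0 : q = ⟨1, F.1.1, mTri⟩
  · rw [hp0, hq0]
  · have hq' := tail_forms F.2 hq hq0
    obtain ⟨⟨⟨a, b, c⟩, huF⟩, hltF⟩ := F
    obtain ⟨w1, w2, w3⟩ := w
    subst hp0
    simp only [hm] at hF1 hF12 hF23 hF4 hq' hpw hw12 hw4 ⊢
    exfalso
    rcases hq' with ⟨hqa, hq⟩ | ⟨hqa, hq⟩ | ⟨hqa, hq⟩ | ⟨hqa1, hqa2, hqa3, hq⟩ <;>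
      rcases hq with rfl | rfl | rfl <;> simp only [Prod.mk.injEq] at hpw hqw <;> omega
  · have hp' := tail_forms F.2 hp hp0
    obtain ⟨⟨⟨a, b, c⟩, huF⟩, hltF⟩ := F
    obtain ⟨w1, w2, w3⟩ := w
    subst hq0
    simp only [hm] at hF1 hF12 hF23 hF4 hp' hqw hw12 hw4 ⊢
    exfalso
    rcases hp' with ⟨hpa, hp⟩ | ⟨hpa, hp⟩ | ⟨hpa, hp⟩ | ⟨hpa1, hpa2, hpa3, hp⟩ <;>
      rcases hp with rfl | rfl | rfl <;> simp only [Prod.mk.injEq] at hpw hqw <;> omega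
  · have hp' := tail_forms F.2 hp hp0
    have hq' := tail_forms F.2 hq hq0
    obtain ⟨⟨⟨a, b, c⟩, huF⟩, hltF⟩ := F
    obtain ⟨w1, w2, w3⟩ := w
    simp only at hF1 hF12 hF23 hF4 hp' hq' hw12 hw4 ⊢
    rcases hp' with ⟨hpa, hp⟩ | ⟨hpa, hp⟩ | ⟨hpa, hp⟩ | ⟨hpa1, hpa2, hpa3, hp⟩ <;>
      rcases hq' with ⟨hqa, hq⟩ | ⟨hqa, hq⟩ | ⟨hqa, hq⟩ | ⟨hqa1, hqa2, hqa3, hq⟩ <;>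
      rcases hp with rfl | rfl | rfl <;> rcases hq with rfl | rfl | rfl <;>
      simp only [Prod.mk.injEq, PlTerm.mk.injEq, true_and, and_true, and_false, false_and, Nat.reduceEqDiff, Int.reduceEq,
        Int.reduceNeg] at hpw hqw ⊢ <;> omega

/-! ## §3 Terms at the platform: positions, chart monomials of non-leading terms, «no double lift» for every `n` -/

/-- An increasing index triple in `[n]` other than `(123)` indexes a Plücker variable.
[cite: Hu2025, §3 (3.5) / Def. 3.7, chunks p0017 l.18–26 / p0018 l.136–142, pp. 35, 39 (unrefereed preprint arXiv:2507.21400v1 under adjudication, D-0012/D-0089 — kernel bookkeeping on OUR typed carriers of rows 101/105; nothing of the source asserted)] -/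
theorem mem_plVarSet_of {n x y z : ℕ} (h1 : 1 ≤ x) (hxy : x < y) (hyz : y < z) (hz : z ≤ n) (hm : 3 < z) :
    (x, y, z) ∈ plVarSet n := by
  rw [plVarSet, Finset.mem_erase]
  refine ⟨?_, ?_⟩
  · intro h
    have h3 := congrArg (fun t : ℕ × ℕ × ℕ => t.2.2) h
    simp only [mTri] at h3
    omega
  · unfold plIndexSet
    simp only [Finset.mem_filter, Finset.mem_product, Finset.mem_Icc]
    omega

/-- Within a block the position of a term is determined by the term (the printed term lists have no repetition).
[cite: Hu2025, §3 (3.10)–(3.13) / §4.1 (4.1), chunks p0018 l.17–33 / p0021 l.22–30, pp. 37, 44 (unrefereed preprint arXiv:2507.21400v1 under adjudication, D-0012/D-0089 — kernel bookkeeping on OUR typed carriers of rows 101/105; nothing of the source asserted)] -/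
theorem termN_injective_in_block {n : ℕ} (G : RelIdx n) {i j : C20L5_SF G.1.1}
    (h : termN (⟨G, i⟩ : TermIdx n) = termN (⟨G, j⟩ : TermIdx n)) : i = j := by
  obtain ⟨-, -, h23, -, h4⟩ := relIdx_coords G
  have hnd := (primaryTerms_pairs_nodup G.1.1 G.2 h23 h4).of_map
  rw [List.nodup_iff_injective_get] at hnd
  exact hnd h

/-- Two terms with the same block and the same printed datum are the same term index.
[cite: Hu2025, §3 (3.10)–(3.13) / §4.1 (4.1), chunks p0018 l.17–33 / p0021 l.22–30, pp. 37, 44 (unrefereed preprint arXiv:2507.21400v1 under adjudication, D-0012/D-0089 — kernel bookkeeping on OUR typed carriers of rows 101/105; nothing of the source asserted)] -/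
theorem termIdx_ext {n : ℕ} {h t : TermIdx n} (hrel : relN n h = relN n t) (hterm : termN h = termN t) : h = t := by
  obtain ⟨G, i⟩ := h
  obtain ⟨G', j⟩ := t
  simp only [relN] at hrel
  subst hrel
  rw [termN_injective_in_block G hterm]

/-- A term other than the leading one of its block is NOT the printed leading datum `(+1, u, m)` (its `v_s ≠ m`).
[cite: Hu2025, §3 (3.10)–(3.13), chunk p0018 l.17–33, p.37 (unrefereed preprint arXiv:2507.21400v1 under adjudication, D-0012/D-0089 — kernel bookkeeping on OUR typed carriers of rows 101/105; nothing of the source asserted)] -/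
theorem termN_ne_headTerm {n : ℕ} (h : TermIdx n) (hh : h ≠ headN n (relN n h)) :
    termN h ≠ ⟨1, (relN n h).1.1, mTri⟩ := by
  intro e
  apply hh
  apply termIdx_ext (relN_headN n (relN n h)).symm
  rw [e, termN_headN]

/-- **The chart monomial of a non-leading term**: both index triples are Plücker variable indices and they are distinct
(`x̄_{u_s} x̄_{v_s}` is a product of two distinct variables).
[cite: Hu2025, §3 (3.10)–(3.13) / (3.15), chunk p0018 l.17–33, l.48–51, pp. 37–38 (unrefereed preprint arXiv:2507.21400v1 under adjudication, D-0012/D-0089 — kernel bookkeeping on OUR typed carriers of rows 101/105; nothing of the source asserted)] -/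
theorem tail_indices {n : ℕ} (h : TermIdx n) (hh : termN h ≠ ⟨1, (relN n h).1.1, mTri⟩) :
    (termN h).us ∈ plVarSet n ∧ (termN h).vs ∈ plVarSet n ∧ (termN h).us ≠ (termN h).vs := by
  obtain ⟨hG1, hG12, hG23, hGn, hG4⟩ := relIdx_coords (relN n h)
  have hforms := tail_forms (relN n h).2 (List.get_mem _ _) hh
  obtain ⟨⟨⟨⟨a, b, c⟩, huG⟩, hltG⟩, i⟩ := h
  simp only [relN] at hG1 hG12 hG23 hGn hG4 hforms ⊢
  unfold termN
  dsimp only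
  rcases hforms with ⟨ha, hp | hp⟩ | ⟨ha, hp | hp⟩ | ⟨ha, hp | hp⟩ | ⟨ha1, ha2, ha3, hp | hp | hp⟩ <;>
    rw [hp] <;>
    exact ⟨mem_plVarSet_of (by omega) (by omega) (by omega) (by omega) (by omega),
      mem_plVarSet_of (by omega) (by omega) (by omega) (by omega) (by omega),
      by simp only [ne_eq, Prod.mk.injEq]; omega⟩

/-- The index triples occurring in a chart monomial: `x ∈ supp (monoN t)` only for `x = u_t` or `x = v_t`.
[cite: Hu2025, §3 (3.15) / §4.1 (4.7), chunks p0018 l.48–51 / p0021 l.122–132, pp. 38, 46 (unrefereed preprint arXiv:2507.21400v1 under adjudication, D-0012/D-0089 — kernel bookkeeping on OUR typed carriers of rows 101/105; nothing of the source asserted)] -/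
theorem eq_of_mem_support_monoN {n : ℕ} (t : TermIdx n) (x : plVar n) (hx : x ∈ (monoN n t).support) :
    x.1 = (termN t).us ∨ x.1 = (termN t).vs := by
  classical
  rw [monoN] at hx
  rcases Finset.mem_union.mp (Finsupp.support_add hx) with h1 | h1
  · exact Or.inl (eq_of_mem_support_plExp _ _ h1).symm
  · exact Or.inr (eq_of_mem_support_plExp _ _ h1).symm

/-- Both index triples of a non-leading term occur in its chart monomial.
[cite: Hu2025, §3 (3.15) / §4.1 (4.7), chunks p0018 l.48–51 / p0021 l.122–132, pp. 38, 46 (unrefereed preprint arXiv:2507.21400v1 under adjudication, D-0012/D-0089 — kernel bookkeeping on OUR typed carriers of rows 101/105; nothing of the source asserted)] -/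
theorem us_vs_mem_support_monoN {n : ℕ} (h : TermIdx n) (hus : (termN h).us ∈ plVarSet n)
    (hvs : (termN h).vs ∈ plVarSet n) :
    (⟨(termN h).us, hus⟩ : plVar n) ∈ (monoN n h).support ∧ (⟨(termN h).vs, hvs⟩ : plVar n) ∈ (monoN n h).support := by
  have h1 : (plExp (n := n) (termN h).us) ⟨(termN h).us, hus⟩ = 1 := by
    unfold plExp; rw [dif_pos hus, Finsupp.single_eq_same]
  have h2 : (plExp (n := n) (termN h).vs) ⟨(termN h).vs, hvs⟩ = 1 := by
    unfold plExp; rw [dif_pos hvs, Finsupp.single_eq_same]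
  constructor <;> rw [Finsupp.mem_support_iff, monoN, Finsupp.add_apply] <;> omega

/-- **Lift of a NON-LEADING term**: if its chart monomial divides the chart monomial of a term `t`, then it IS `t`
(every `n`; via `tail_pair_injective`).
[cite: Hu2025, §3 (3.10)–(3.13) / §4.2.2 remark p0023 l.47–48, pp. 37, 50 (unrefereed preprint arXiv:2507.21400v1 under adjudication, D-0012/D-0089 — kernel bookkeeping on OUR typed carriers of rows 101/103/105; nothing of the source asserted)] -/
theorem eq_of_monoN_le_of_tail {n : ℕ} (h t : TermIdx n) (hh : h ≠ headN n (relN n h)) (hle : monoN n h ≤ monoN n t) :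
    h = t := by
  have hht := termN_ne_headTerm h hh
  obtain ⟨hus, hvs, huv⟩ := tail_indices h hht
  obtain ⟨hsu, hsv⟩ := us_vs_mem_support_monoN h hus hvs
  have hsub := Finsupp.support_mono hle
  have hu := eq_of_mem_support_monoN t _ (hsub hsu)
  have hv := eq_of_mem_support_monoN t _ (hsub hsv)
  simp only at hu hv
  -- `t` is not a leading term: its chart monomial has two distinct variables
  by_cases ht : t = headN n (relN n t)
  · exfalso
    rw [ht, termN_headN] at hu hv
    simp only at hu hv
    obtain ⟨-, -, -, -, h4⟩ := relIdx_coords (relN n t)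
    have hm : mTri.2.1 = 2 := rfl
    rcases hu with hu | hu <;> rcases hv with hv | hv
    · exact huv (hu.trans hv.symm)
    · have := congrArg (fun w : ℕ × ℕ × ℕ => w.2.1) hv; simp only [hm] at this
      have h3 := (tail_indices h hht).2.1
      rw [hv, plVarSet, Finset.mem_erase] at h3
      exact h3.1 rfl
    · have h3 := (tail_indices h hht).1
      rw [hu, plVarSet, Finset.mem_erase] at h3
      exact h3.1 rfl
    · exact huv (hu.trans hv.symm)
  have htt := termN_ne_headTerm t ht
  have hs : s((termN h).us, (termN h).vs) = s((termN t).us, (termN t).vs) := by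
    rw [Sym2.eq_iff]
    rcases hu with hu | hu <;> rcases hv with hv | hv
    · exact absurd (hu.trans hv.symm) huv
    · exact Or.inl ⟨hu, hv⟩
    · exact Or.inr ⟨hu, hv⟩
    · exact absurd (hu.trans hv.symm) huv
  obtain ⟨hrel, hterm⟩ := tail_pair_injective (relN n h) (relN n t) (List.get_mem _ _) hht (List.get_mem _ _) htt hs
  exact termIdx_ext hrel hterm

/-- **Lift of a LEADING term**: if `x_{u_G}` divides the chart monomial of `t`, then `u_G` is one of `t`'s index triples.
[cite: Hu2025, §3 (3.10)–(3.13) / (3.15), chunk p0018 l.17–33, l.48–51, pp. 37–38 (unrefereed preprint arXiv:2507.21400v1 under adjudication, D-0012/D-0089 — kernel bookkeeping on OUR typed carriers of rows 101/105; nothing of the source asserted)] -/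
theorem index_mem_of_monoN_head_le {n : ℕ} (G : RelIdx n) (t : TermIdx n) (hle : monoN n (headN n G) ≤ monoN n t) :
    (termN t).us = G.1.1 ∨ (termN t).vs = G.1.1 := by
  have hsub := Finsupp.support_mono hle
  have hx : (⟨G.1.1, mem_plVarSet_of_relIdx n G⟩ : plVar n) ∈ (monoN n (headN n G)).support := by
    rw [monoN_headN, Finsupp.mem_support_iff, Finsupp.single_eq_same]; exact one_ne_zero
  rcases eq_of_mem_support_monoN t _ (hsub hx) with h1 | h1
  · exact Or.inl h1.symm
  · exact Or.inr h1.symm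

/-- A leading index `u_G` occurring in the term `t` of the block `F` pins `t` down: if it also occurs in `t′` of the same
block then `t = t′` (`ltIndex_unique_in_block` on term indices).
[cite: Hu2025, §3 (3.10)–(3.13), chunk p0018 l.17–33, p.37 (unrefereed preprint arXiv:2507.21400v1 under adjudication, D-0012/D-0089 — kernel bookkeeping on OUR typed carriers of rows 101/105; nothing of the source asserted)] -/
theorem eq_of_index_mem_both {n : ℕ} (G : RelIdx n) {t t' : TermIdx n} (htt' : relN n t = relN n t')
    (ht : (termN t).us = G.1.1 ∨ (termN t).vs = G.1.1) (ht' : (termN t').us = G.1.1 ∨ (termN t').vs = G.1.1) : t = t' := by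
  obtain ⟨-, hG12, -, -, hG4⟩ := relIdx_coords G
  apply termIdx_ext htt'
  have hq : termN t' ∈ primaryTerms (relN n t).1.1 := by rw [htt']; exact List.get_mem _ _
  exact ltIndex_unique_in_block (relN n t) hG12 hG4 (List.get_mem _ _) hq ht ht'

/-- **NO DOUBLE LIFT at every platform `Gr^{3,n}`** (the hypothesis `hNL` of `C23L47_R3_of_noDoubleLift` for `relN n`, `monoN n`):
for two distinct terms `t ≠ t′` of one block, the only pair `h₁, h₂` of terms of a common block with `x̄_{h₁} ∣ x̄_{t′}` and
`x̄_{h₂} ∣ x̄_t` is `(t′, t)`.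
[cite: Hu2025, §3 (3.10)–(3.13) / §4.2.2 remark p0023 l.47–48, pp. 37, 50 (unrefereed preprint arXiv:2507.21400v1 under adjudication, D-0012/D-0089 — kernel bookkeeping on OUR typed carriers of rows 101/103/105; nothing of the source asserted)] -/
theorem noDoubleLift {n : ℕ} (t t' : TermIdx n) (htt' : relN n t = relN n t') (hne : t ≠ t') (h₁ h₂ : TermIdx n)
    (hh : relN n h₁ = relN n h₂) (hle₁ : monoN n h₁ ≤ monoN n t') (hle₂ : monoN n h₂ ≤ monoN n t) :
    h₁ = t' ∧ h₂ = t := by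
  by_cases hh₁ : h₁ = headN n (relN n h₁) <;> by_cases hh₂ : h₂ = headN n (relN n h₂)
  · -- both leading: the same leading variable would divide two distinct terms of one block
    exfalso
    rw [hh₁] at hle₁
    rw [hh₂, ← hh] at hle₂
    exact hne (eq_of_index_mem_both (relN n h₁) htt' (index_mem_of_monoN_head_le _ _ hle₂)
      (index_mem_of_monoN_head_le _ _ hle₁))
  · have h2 := eq_of_monoN_le_of_tail h₂ t hh₂ hle₂
    refine ⟨?_, h2⟩
    subst h2
    -- `h₁` is the leading term of the block of `h₂ = t`, i.e. of `t′`
    rw [hh₁] at hle₁ ⊢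
    rw [hh, htt']
    have ht' := index_mem_of_monoN_head_le _ _ hle₁
    rw [hh, htt'] at ht'
    have hhd : (termN (headN n (relN n t'))).us = (relN n t').1.1 ∨ (termN (headN n (relN n t'))).vs = (relN n t').1.1 := by
      rw [termN_headN]; exact Or.inl rfl
    exact eq_of_index_mem_both (relN n t') (relN_headN n _) hhd ht'
  · have h1 := eq_of_monoN_le_of_tail h₁ t' hh₁ hle₁
    refine ⟨h1, ?_⟩
    subst h1
    rw [hh₂] at hle₂ ⊢
    rw [← hh, ← htt']
    have ht := index_mem_of_monoN_head_le _ _ hle₂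
    rw [← hh, ← htt'] at ht
    have hhd : (termN (headN n (relN n t))).us = (relN n t).1.1 ∨ (termN (headN n (relN n t))).vs = (relN n t).1.1 := by
      rw [termN_headN]; exact Or.inl rfl
    exact eq_of_index_mem_both (relN n t) (relN_headN n _) hhd ht
  · exact ⟨eq_of_monoN_le_of_tail h₁ t' hh₁ hle₁, eq_of_monoN_le_of_tail h₂ t hh₂ hle₂⟩

/-- **Hu 2025, remark after Ex. 4.14 ‹chunk 4.13› IN READING R3 — HOLDS AT EVERY PLATFORM `Gr^{3,n}`** (every `n`, every
commutative coefficient ring, every set `Φ` of relations in play): `C23L47_R3 (relN n) (monoN n) Φ`.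
[cite: Hu2025, §4.2.2 remark after Ex. 4.14 ‹chunk Ex. 4.13› «a ℘-binomial does not admit any non-zero root parent», chunk p0023 l.47–48, p.50 L027; §3 (3.10)–(3.13) (unrefereed preprint arXiv:2507.21400v1 under adjudication, D-0012/D-0089 — kernel support on OUR typed rendering `C23L47_R3` of row 103 file d at every platform instantiation; nothing of the source asserted)] -/
theorem C23L47_R3_platform (n : ℕ) (k : Type) [CommRing k] (Φ : Set (RelIdx n)) :
    C23L47_R3 (k := k) (σ := plVar n) (relN n) (monoN n) Φ := by
  classical
  exact C23L47_R3_of_noDoubleLift (k := k) (relN n) (monoN n) Φ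
    (fun t t' htt' hne _ h₁ h₂ hh hle₁ hle₂ => noDoubleLift t t' htt' hne h₁ h₂ hh hle₁ hle₂)

end Literature.AlgebraicGeometry.Hu2025.Proofs.S04ModelV

end
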